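import Summits.Ventures.PercRepro.RLSRuleOneLineFiveGeom
import Summits.Ventures.PercRepro.RLSZeroWorldT1B
import Summits.Ventures.PercRepro.RLSPlanesT1_1
import Summits.Ventures.PercRepro.RLSSmallP
import Summits.Ventures.PercRepro.RLSRuleTwoLines

/-!
# C-025 at q = 3: `R₃⁺` on the `5`-point plane «`3`-point line + two points» at `t = 1` (night-3, gen 4)

`G = ℓ ∪ {a, b}` (`OneLine M G ℓ`, `|G| = 5`) at `t = 1` (`ρ(E ∖ G) = p − 1`, `|K| = n + 3`, the hyperplane
`H = cl(E ∖ G)`): a GLOBAL accounting over all `15` rank-`3` subsets.  Two cases.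

* (A) `ℓ ⊄ H`: no coplanar triple, every witness is good, the demand is at most `14`, and the CRUDE shares
  `ρ₃(B′)/C(b + x, 3)` pay `14Φ` (`9q₀ + 18q₁ + 9q₂ ≥ 14Φ`: `U1.Planes1.plane5_t1` for `n ≥ 6`,
  `SmallP.plane5_t1_n4/n5`; margin `3.68` at `p = 8`) — unlike the plane with two lines, no exact denominator is needed;
* (B) `ℓ ⊆ H`: the refined demand leaves at most `8` bottom sets (`card_UqG_le_of_line_subset_closure`), and the crude
  shares with the `(L3)` loss on the three sets through `ℓ` (`3(t1z1 − lost4)` per lined `4`-set, `9(t1z2 − lost5)`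
  for the plane) pay `8Φ` by the lifted certificate `W1.t1_one5B` (margins `60.1 / 99.7 / 164.4` at `n = 4, 5, 6`).

**`perFlat_oneLineFive_t1`**: every finite matroid with `ρ(E ∖ G) = p − 1`, every `p = n + 4 ≥ 8`.
Imports `RLSRuleOneLineFiveGeom`, `RLSZeroWorldT1B`, the landed tables `RLSPlanesT1_1`, `RLSSmallP`.  Axioms: standard.
-/

open scoped Matroid

namespace PercRepro

namespace NightThree

open Finset ThmH PerFlat

variable {α : Type*} [DecidableEq α] {M : Matroid α} [M.Finite]

open scoped Classical in
/-- **`t = 1`, the line outside `cl(E ∖ G)`**: demand `≤ 14`, crude shares, `9q₀ + 18q₁ + 9q₂ ≥ 14Φ`. -/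
theorem perFlat_oneLineFive_t1_of_not_subset {G ℓ : Finset α} {n : ℕ} (hG : G ∈ flatsQ M 3)
    (h : OneLine M G ℓ) (hGc : G.card = 5) (hn : 4 ≤ n)
    (hK : M.eRk ((gr M \ G : Finset α) : Set α) = ((n + 3 : ℕ) : ℕ∞))
    (hℓ : ¬ (ℓ : Set α) ⊆ M.closure ((gr M \ G : Finset α) : Set α)) :
    phiK (n + 4) 3 * ((UqG M (n + 4) 3 G).card : ℚ) ≤ ∑ S ∈ Yq M (n + 4) 3, wPlus M G S := by
  obtain ⟨K, hKsub, hKind, hKcard⟩ := exists_indep_compl_card G (p := n + 3) (le_of_eq hK.symm)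
  have hKG : Disjoint K G := by
    rw [Finset.disjoint_left]
    intro x hxK hxG
    have := hKsub hxK
    rw [Finset.mem_sdiff] at this
    exact this.2 hxG
  obtain ⟨hmem3, h𝔅rank, hd34, hd5, hc3, hc4⟩ := oneLineFive_family hG h hGc
  obtain ⟨hℓG, hℓc, hℓr, hone⟩ := h
  have h' : OneLine M G ℓ := ⟨hℓG, hℓc, hℓr, hone⟩
  have hGE : G ⊆ gr M := (mem_flatsQ.1 hG).1
  have hgood : ∀ X, GoodWitness M ℓ K X := by
    intro X C hC
    have hℓE : (ℓ : Set α) ⊆ M.E := by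
      rw [← coe_gr M]; exact Finset.coe_subset.2 (hℓG.trans hGE)
    rw [coplanarTriples_eq_empty_of_not_subset hℓE hKsub hKind hℓ] at hC
    exact absurd hC (Finset.notMem_empty C)
  -- the demand: at most `14`
  have hdem : ((UqG M (n + 4) 3 G).card : ℚ) ≤ 14 := by
    calc ((UqG M (n + 4) 3 G).card : ℚ)
        ≤ (((G.powersetCard 3).erase ℓ ∪ G.powersetCard 4).card : ℚ) := by
          exact_mod_cast Finset.card_le_card (UqG_subset_of_oneLineFive_t1 h' hGc hK)
      _ ≤ (((G.powersetCard 3).erase ℓ).card : ℚ) + ((G.powersetCard 4).card : ℚ) := by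
          exact_mod_cast Finset.card_union_le _ _
      _ = 14 := by rw [hc3, hc4]; norm_num
  -- the crude shares
  set f : Finset α → Finset α → ℚ := fun B X =>
    ((B.card.choose 3 - (if ℓ ⊆ B then 1 else 0) : ℕ) : ℚ) / (((B.card + X.card).choose 3 : ℕ) : ℚ) with hf
  have hsup := supply_ge_of_family hG h𝔅rank hKsub hKind n f (fun B hB X hX => by
    obtain ⟨hXK, _, _⟩ := mem_witnessFamily hX
    have hXind : M.Indep (X : Set α) := hKind.subset (Finset.coe_subset.2 hXK)
    have hXG : Disjoint X G := Finset.disjoint_of_subset_left hXK hKG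
    have hBG := (h𝔅rank B hB).1
    have hB5 : B.card ≤ 5 := by rw [← hGc]; exact Finset.card_le_card hBG
    have hw := wPlus_ge_of_oneLine hG h' hBG hXind hXG hXK (Or.inr (hgood X))
    rw [if_pos hB5] at hw
    exact hw)
  -- the sums
  have h3 : ∑ B ∈ (G.powersetCard 3).erase ℓ, ∑ X ∈ witnessFamily K n, f B X = 9 * W1.t1z0Sum n := by
    have hval : ∀ B ∈ (G.powersetCard 3).erase ℓ, ∑ X ∈ witnessFamily K n, f B X = W1.t1z0Sum n := by
      intro B hB
      obtain ⟨_, hBc, hl, _⟩ := hmem3 B hB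
      have : ∀ X ∈ witnessFamily K n, f B X = 1 / (((3 + X.card).choose 3 : ℕ) : ℚ) := by
        intro X _
        rw [hf]
        dsimp only
        rw [hBc]
        simp only [if_neg hl, Nat.choose_self, Nat.sub_zero, Nat.cast_one]
      rw [Finset.sum_congr rfl this, sum_witness_eq_t1z0 hKcard]
    rw [Finset.sum_congr rfl hval, Finset.sum_const, hc3, nsmul_eq_mul]
    norm_num
  have h4 : ∑ B ∈ G.powersetCard 4, ∑ X ∈ witnessFamily K n, f B X =
      2 * (3 * W1.t1z1Sum n) + 3 * (4 * W1.t1z1Sum n) := by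
    apply sum_powersetCard_four_oneLine hℓG hℓc hGc
    · intro B hB hl
      have hBc := (Finset.mem_powersetCard.1 hB).2
      have hval : ∀ X ∈ witnessFamily K n, f B X = 3 / (((4 + X.card).choose 3 : ℕ) : ℚ) := by
        intro X _
        rw [hf]
        dsimp only
        rw [hBc, show Nat.choose 4 3 = 4 by norm_num [Nat.choose]]
        simp only [if_pos hl]
        norm_num
      rw [Finset.sum_congr rfl hval, sum_witness_eq_t1z1 hKcard]
    · intro B hB hl
      have hBc := (Finset.mem_powersetCard.1 hB).2
      have hval : ∀ X ∈ witnessFamily K n, f B X = 4 / (((4 + X.card).choose 3 : ℕ) : ℚ) := by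
        intro X _
        rw [hf]
        dsimp only
        rw [hBc, show Nat.choose 4 3 = 4 by norm_num [Nat.choose]]
        simp only [if_neg hl, Nat.sub_zero]
        norm_num
      rw [Finset.sum_congr rfl hval, sum_witnessFamily K n (fun x => 4 / (((4 + x).choose 3 : ℕ) : ℚ)), hKcard]
      unfold W1.t1z1Sum
      rw [Finset.mul_sum]
      apply Finset.sum_congr rfl
      intro i _
      rw [show 4 + (i + 1) = i + 5 by omega]
      ring
  have h5 : ∑ X ∈ witnessFamily K n, f G X = 9 * W1.t1z2Sum n := by
    have hval : ∀ X ∈ witnessFamily K n, f G X = 9 / (((5 + X.card).choose 3 : ℕ) : ℚ) := by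
      intro X _
      rw [hf]
      dsimp only
      rw [hGc, show Nat.choose 5 3 = 10 by norm_num [Nat.choose]]
      simp only [if_pos hℓG]
      norm_num
    rw [Finset.sum_congr rfl hval, sum_witnessFamily K n (fun x => 9 / (((5 + x).choose 3 : ℕ) : ℚ)), hKcard]
    unfold W1.t1z2Sum
    rw [Finset.mul_sum]
    apply Finset.sum_congr rfl
    intro i _
    rw [show 5 + (i + 1) = i + 6 by omega]
    ring
  -- the certificate (`W1.t1z*Sum = U1.q*Sum` by definition)
  have hphi : phiK (n + 4) 3 = ∑ i ∈ range n, ((n + 4).choose (i + 1) : ℚ) / ((i + 4).choose 3 : ℚ) := by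
    unfold phiK
    rw [phiW_eq_phiK_form n]
    rfl
  have hcert : phiK (n + 4) 3 * 14 ≤ 9 * U1.q0Sum n + 18 * U1.q1Sum n + 9 * U1.q2Sum n := by
    rw [hphi]
    rcases (show n = 4 ∨ n = 5 ∨ 6 ≤ n by omega) with h4' | h5' | h6
    · subst h4'; exact SmallP.plane5_t1_n4
    · subst h5'; exact SmallP.plane5_t1_n5
    · exact U1.Planes1.plane5_t1 n h6
  have hq0 : W1.t1z0Sum n = U1.q0Sum n := rfl
  have hq1 : W1.t1z1Sum n = U1.q1Sum n := rfl
  have hq2 : W1.t1z2Sum n = U1.q2Sum n := rfl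
  calc phiK (n + 4) 3 * ((UqG M (n + 4) 3 G).card : ℚ)
      ≤ phiK (n + 4) 3 * 14 := mul_le_mul_of_nonneg_left hdem (phiK_nonneg _ _)
    _ ≤ 9 * U1.q0Sum n + 18 * U1.q1Sum n + 9 * U1.q2Sum n := hcert
    _ = ∑ B ∈ (G.powersetCard 3).erase ℓ ∪ G.powersetCard 4 ∪ {G}, ∑ X ∈ witnessFamily K n, f B X := by
        rw [Finset.sum_union hd5, Finset.sum_union hd34, Finset.sum_singleton, h3, h4, h5, hq0, hq1, hq2]
        ring
    _ ≤ ∑ S ∈ Yq M (n + 4) 3, wPlus M G S := hsup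

open scoped Classical in
/-- **`t = 1`, the line inside `cl(E ∖ G)`**: refined demand `≤ 8`, crude shares with the `(L3)` loss on the three
sets through `ℓ`, the lifted certificate `W1.t1_one5B`. -/
theorem perFlat_oneLineFive_t1_of_subset {G ℓ : Finset α} {n : ℕ} (hG : G ∈ flatsQ M 3)
    (h : OneLine M G ℓ) (hGc : G.card = 5) (hn : 4 ≤ n)
    (hK : M.eRk ((gr M \ G : Finset α) : Set α) = ((n + 3 : ℕ) : ℕ∞))
    (hℓ : (ℓ : Set α) ⊆ M.closure ((gr M \ G : Finset α) : Set α)) :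
    phiK (n + 4) 3 * ((UqG M (n + 4) 3 G).card : ℚ) ≤ ∑ S ∈ Yq M (n + 4) 3, wPlus M G S := by
  obtain ⟨K, hKsub, hKind, hKcard⟩ := exists_indep_compl_card G (p := n + 3) (le_of_eq hK.symm)
  have hKG : Disjoint K G := by
    rw [Finset.disjoint_left]
    intro x hxK hxG
    have := hKsub hxK
    rw [Finset.mem_sdiff] at this
    exact this.2 hxG
  obtain ⟨hmem3, h𝔅rank, hd34, hd5, hc3, hc4⟩ := oneLineFive_family hG h hGc
  obtain ⟨hℓG, hℓc, hℓr, hone⟩ := h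
  have h' : OneLine M G ℓ := ⟨hℓG, hℓc, hℓr, hone⟩
  obtain ⟨C, hCK, hCc, hgoodC⟩ := exists_good_triple hG hℓG hℓr hKsub hKind (by omega)
  -- the refined demand: at most `8`
  have hdem : ((UqG M (n + 4) 3 G).card : ℚ) ≤ 8 := by
    have := card_UqG_le_of_line_subset_closure (p := n + 4) hℓG hℓc hℓr hGc hℓ
      (by rw [hK]; exact_mod_cast (by omega : n + 3 < n + 4))
    exact_mod_cast this
  -- the crude shares on the good witnesses
  set f : Finset α → Finset α → ℚ := fun B X =>
    if ℓ ⊆ B → ¬ C ⊆ X then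
      ((B.card.choose 3 - (if ℓ ⊆ B then 1 else 0) : ℕ) : ℚ) / (((B.card + X.card).choose 3 : ℕ) : ℚ)
    else 0 with hf
  have hsup := supply_ge_of_family hG h𝔅rank hKsub hKind n f (fun B hB X hX => by
    obtain ⟨hXK, _, _⟩ := mem_witnessFamily hX
    have hXind : M.Indep (X : Set α) := hKind.subset (Finset.coe_subset.2 hXK)
    have hXG : Disjoint X G := Finset.disjoint_of_subset_left hXK hKG
    have hBG := (h𝔅rank B hB).1
    have hB5 : B.card ≤ 5 := by rw [← hGc]; exact Finset.card_le_card hBG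
    rw [hf]
    dsimp only
    by_cases hgd : ℓ ⊆ B → ¬ C ⊆ X
    · rw [if_pos hgd]
      have hcase : ¬ ℓ ⊆ B ∨ GoodWitness M ℓ K X := by
        by_cases hl : ℓ ⊆ B
        · exact Or.inr (hgoodC X (hgd hl))
        · exact Or.inl hl
      have hw := wPlus_ge_of_oneLine hG h' hBG hXind hXG hXK hcase
      rw [if_pos hB5] at hw
      exact hw
    · rw [if_neg hgd]
      exact wPlus_nonneg M G (B ∪ X))
  -- the sums
  have h3 : ∑ B ∈ (G.powersetCard 3).erase ℓ, ∑ X ∈ witnessFamily K n, f B X = 9 * W1.t1z0Sum n := by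
    have hval : ∀ B ∈ (G.powersetCard 3).erase ℓ, ∑ X ∈ witnessFamily K n, f B X = W1.t1z0Sum n := by
      intro B hB
      obtain ⟨_, hBc, hl, _⟩ := hmem3 B hB
      have : ∀ X ∈ witnessFamily K n, f B X = 1 / (((3 + X.card).choose 3 : ℕ) : ℚ) := by
        intro X _
        rw [hf]
        dsimp only
        rw [if_pos (fun h => absurd h hl), hBc]
        simp only [if_neg hl, Nat.choose_self, Nat.sub_zero, Nat.cast_one]
      rw [Finset.sum_congr rfl this, sum_witness_eq_t1z0 hKcard]
    rw [Finset.sum_congr rfl hval, Finset.sum_const, hc3, nsmul_eq_mul]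
    norm_num
  have h4 : ∑ B ∈ G.powersetCard 4, ∑ X ∈ witnessFamily K n, f B X =
      2 * (3 * W1.t1z1Sum n - 3 * W1.t1lost4Sum n) + 3 * (4 * W1.t1z1Sum n) := by
    apply sum_powersetCard_four_oneLine hℓG hℓc hGc
    · intro B hB hl
      have hBc := (Finset.mem_powersetCard.1 hB).2
      have hval : ∀ X ∈ witnessFamily K n, f B X =
          if ¬ C ⊆ X then 3 / (((4 + X.card).choose 3 : ℕ) : ℚ) else 0 := by
        intro X _
        rw [hf]
        dsimp only
        by_cases hCX : C ⊆ X
        · rw [if_neg (fun hgd => hgd hl hCX), if_neg (by tauto)]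
        · rw [if_pos (fun _ => hCX), if_pos hCX, hBc, show Nat.choose 4 3 = 4 by norm_num [Nat.choose]]
          simp only [if_pos hl]
          norm_num
      rw [Finset.sum_congr rfl hval, ← Finset.sum_filter, sum_good_four_t1 (by omega) hKcard hCK hCc]
    · intro B hB hl
      have hBc := (Finset.mem_powersetCard.1 hB).2
      have hval : ∀ X ∈ witnessFamily K n, f B X = 4 / (((4 + X.card).choose 3 : ℕ) : ℚ) := by
        intro X _
        rw [hf]
        dsimp only
        rw [if_pos (fun h => absurd h hl), hBc, show Nat.choose 4 3 = 4 by norm_num [Nat.choose]]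
        simp only [if_neg hl, Nat.sub_zero]
        norm_num
      rw [Finset.sum_congr rfl hval, sum_witnessFamily K n (fun x => 4 / (((4 + x).choose 3 : ℕ) : ℚ)), hKcard]
      unfold W1.t1z1Sum
      rw [Finset.mul_sum]
      apply Finset.sum_congr rfl
      intro i _
      rw [show 4 + (i + 1) = i + 5 by omega]
      ring
  have h5 : ∑ X ∈ witnessFamily K n, f G X = 9 * W1.t1z2Sum n - 9 * W1.t1lost5Sum n := by
    have hval : ∀ X ∈ witnessFamily K n, f G X =
        if ¬ C ⊆ X then 9 / (((5 + X.card).choose 3 : ℕ) : ℚ) else 0 := by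
      intro X _
      rw [hf]
      dsimp only
      by_cases hCX : C ⊆ X
      · rw [if_neg (fun hgd => hgd hℓG hCX), if_neg (by tauto)]
      · rw [if_pos (fun _ => hCX), if_pos hCX, hGc, show Nat.choose 5 3 = 10 by norm_num [Nat.choose]]
        simp only [if_pos hℓG]
        norm_num
    rw [Finset.sum_congr rfl hval, ← Finset.sum_filter, sum_good_five_t1 (by omega) hKcard hCK hCc]
  -- the certificate
  have hphi : phiK (n + 4) 3 = ∑ i ∈ range n, ((n + 4).choose (i + 1) : ℚ) / ((i + 4).choose 3 : ℚ) := by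
    unfold phiK
    rw [phiW_eq_phiK_form n]
    rfl
  have hcert := W1.t1_one5B n hn
  rw [← hphi] at hcert
  calc phiK (n + 4) 3 * ((UqG M (n + 4) 3 G).card : ℚ)
      ≤ phiK (n + 4) 3 * 8 := mul_le_mul_of_nonneg_left hdem (phiK_nonneg _ _)
    _ = 8 * phiK (n + 4) 3 := by ring
    _ ≤ ∑ B ∈ (G.powersetCard 3).erase ℓ ∪ G.powersetCard 4 ∪ {G}, ∑ X ∈ witnessFamily K n, f B X := by
        rw [Finset.sum_union hd5, Finset.sum_union hd34, Finset.sum_singleton, h3, h4, h5]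
        linarith
    _ ≤ ∑ S ∈ Yq M (n + 4) 3, wPlus M G S := hsup

/-- **`R₃⁺` at `t = 1` on the plane `ℓ ∪ {a, b}`**, every `p = n + 4 ≥ 8`, every finite matroid with
`ρ(E ∖ G) = p − 1`. -/
theorem perFlat_oneLineFive_t1 {G ℓ : Finset α} {n : ℕ} (hG : G ∈ flatsQ M 3) (h : OneLine M G ℓ)
    (hGc : G.card = 5) (hn : 4 ≤ n) (hK : M.eRk ((gr M \ G : Finset α) : Set α) = ((n + 3 : ℕ) : ℕ∞)) :
    phiK (n + 4) 3 * ((UqG M (n + 4) 3 G).card : ℚ) ≤ ∑ S ∈ Yq M (n + 4) 3, wPlus M G S := by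
  by_cases hℓ : (ℓ : Set α) ⊆ M.closure ((gr M \ G : Finset α) : Set α)
  · exact perFlat_oneLineFive_t1_of_subset hG h hGc hn hK hℓ
  · exact perFlat_oneLineFive_t1_of_not_subset hG h hGc hn hK hℓ

end NightThree

end PercRepro
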